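import Summits.PneNP.PneNP.Theses.SymmetryBudget
import Literature.Computability.Complexity.SymmetricCircuit
import HarnessLib.Audit

/-!
# Line `entropy-support-dichotomy` — skeleton for crux `SymmetryBudget.WindowBarrier`
(item stmt-PneNP-2145, route route-PneNP-SymmetryBudget; crux idea card
`entropy-support-dichotomy`, ideator cruxidea-stmt-PneNP-2145-1, evidence 20260815T232853Z;
triage r1-1: pass, with the sharpening "state EST asymptotically / with existential constants").

## The line in one paragraph

In the window `g = ⌊log₂ m⌋` a Bud-symmetric circuit of polynomial size `m^c = 2^{c(g+1)}` has gate
stabilisers of index `≤ 2^{O(g)}` in `Bud(m,g) ≅ Sym_g` — too large for the Dawar–Wilsenach support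
theorem (index `< C(g,k)`), which is why every published symmetric lower bound is void there. The
lever is an ENTROPY SUPPORT THEOREM (EST, pure permutation-group theory): EVERY subgroup
`H ≤ Sym(Fin g)` contains the in-block even permutations `∏ᵢ Alt(Bᵢ)` of a partition
`{B₁, …, B_r}` of `Fin g` whose Shannon entropy `Σᵢ |Bᵢ| log₂ (g/|Bᵢ|)` is `O(log₂ |Sym : H| + g)`
(singletons allowed; they are the classical "support"). Hence every gate of a window circuit has a
BLOCK SUPPORT of entropy `O(c·g)` (`stub_windowSupports`), and an Anderson–Dawar-type induction
along the circuit shows that such circuits cannot tell apart two inputs on which Duplicator wins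
the ENTROPY GAME — Hella's bijective pebble game with the pebble budget replaced by an entropy
budget on a partition of the free part that Spoiler refines one split at a time
(`stub_gameInvariance`). The crux `WindowBarrier` then reduces to, and follows from, a WITNESS:
a polynomial-time, Bud-invariant property of graphs and, for every entropy rate `D`, infinitely many
`m` with a pair of inputs separated by the property but `D·g`-game-equivalent (`stub_witness`, the
open core "K3" of the card: CFI / vertex-gadget 𝔽₂ witnesses die at rate `D ≈ 1`, one bisection
freezing the gauge — the card's barrier notes BN1–3).

## Stubs (5) and glue

* `stub_primitiveOrderBound` (M/L, KNOWN: Praeger–Saxl 1980, Maróti 2002) — a primitive group of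
  degree `n` not containing `Alt(n)` has order `≤ 2^{K n}` (`PrimitiveOrderBound`, stated with an
  existential `K`; `K = 2` is Praeger–Saxl). Not in Mathlib (`MulAction.IsPreprimitive` is).
* `stub_est` (L, NEW as stated) — `PrimitiveOrderBound → EntropySupportTheorem`: orbit/multinomial
  count, imprimitive reduction to wreath products, the primitive bound on top actions, and a
  Goursat/diagonal argument excluding linked alternating blocks; explicit constants, NO threshold
  `g ≥ g₀` (answers triage objection (i): the hyperoctahedral `S₂ ≀ S_{g/2}` has index
  `2^{Θ(g log g)}` and is allotted entropy `Θ(g log g)`).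
* `stub_windowSupports` (M) — `EntropySupportTheorem → WindowSupports`: for a
  `Bud(m,⌊log₂ m⌋)`-symmetric circuit of size `≤ p(m)` every gate stabiliser is a subgroup of
  `Bud` of index `≤ |C|` (coset injection into the gates — the non-rigid orbit–stabiliser count),
  transport `Bud(m,g) ≅ Sym(Fin g)`, apply EST: block supports of entropy `≤ D_p (log₂ m + 1)`.
* `stub_gameInvariance` (L/XL, NEW) — `GameInvariance`: block supports of entropy `≤ B` for every
  gate of a `tcBasis`, Bud-symmetric circuit ⇒ equal outputs on `GameEquiv`-alent inputs at budget
  `A (B + log₂ g + 1)`; the block analogue of Anderson–Dawar 2017 Thm. 6 / Claims 27–28, whose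
  point-support version is PROVED in tree (`AndersonDawar2016_supports_countingWidth_holds`,
  constant `2k+2`, via `BijPebbleStrategy.sum_indicator_eq`).
* `stub_witness` (XL, OPEN CORE, hardest) — `FoolingWitness`.
* Glue (sorry-free): `GameEquiv.mono` (a larger Spoiler budget only restricts Duplicator) and the
  composition `WindowBarrier_of`, which concludes the crux BY NAME: the frame `∃ L ∈ P, invariant ∧
  ∀ p, ∃ᶠ m, ¬HasSym` is literally assembled from the witness (`L`, invariance, fooling pairs),
  `WindowSupports` at `p`, `GameInvariance`, and the arithmetic
  `A (D(g+1) + log₂ g + 1) ≤ 2A(D+1)·g` for `g = ⌊log₂ m⌋ ≥ 1` (`m ≥ 2`, eventually).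

## Disproof.lean / negatives

No `Cruxes/WindowBarrier/Disproof.lean` and no landed `Theorems/WindowBarrier/Negative/` lemma
exist at planning time (crux dir holds only TRIAGE-r1-1.md); nothing to import or honour yet.
`ledger negatives --problem PneNP` (5 items: magnification frontier, OR-compression, Lyapunov/PHP,
Bavard gap, two-tones) — none concerns symmetric circuits; no stub restates one.
-/

noncomputable section

open Filter Finset
open scoped Classical
open Literature.Computability.Complexity
open Summit.PneNP.PneNP.Theses.SymmetryBudget

namespace Summit.PneNP.PneNP.Cruxes.WindowBarrier.EntropySupportDichotomy

/-! ## Vocabulary of the line (transparent definitions over tree declarations) -/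

/-- The route's reading of an `m × m` Boolean matrix as a simple graph (verbatim the inline `Gr` of
`SymmetryBudget`: symmetrised, loops dropped). -/
abbrev Gr (m : ℕ) (x : Fin m × Fin m → Bool) : SimpleGraph (Fin m) :=
  SimpleGraph.fromRel fun u v => x (u, v) = true

/-- A point of `Fin m` is FREE for the budget `g` if it is one of the last `g` points (the points
moved by `pointStabiliserBudget m g`; all points if `m ≤ g`). -/
@[folklore] def IsFree (m g : ℕ) (i : Fin m) : Prop := m ≤ (i : ℕ) + g

/-- The number of free points (`= min g m`). -/
@[folklore] def freeCard (m g : ℕ) : ℕ := (univ.filter fun i : Fin m => IsFree m g i).card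

/-- A SHAPE is a labelling `ℓ : Fin m → ℕ`; only the partition it induces on the free points
matters. `classCard m g ℓ i` is the number of free points carrying the label of `i`. -/
@[folklore] def classCard (m g : ℕ) (ℓ : Fin m → ℕ) (i : Fin m) : ℕ :=
  (univ.filter fun i' : Fin m => IsFree m g i' ∧ ℓ i' = ℓ i).card

/-- **Entropy of a shape** (in bits, not normalised): `Σ_{i free} log₂ (#free / #class(i))`
`= Σ_{classes B} |B| log₂ (#free/|B|)`. A singleton class costs `log₂ #free` (a classical support
point), a bisection costs `#free`, the one-class shape costs `0`. -/
@[folklore] def ent (m g : ℕ) (ℓ : Fin m → ℕ) : ℝ :=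
  ∑ i : Fin m, if IsFree m g i then
    Real.logb 2 ((freeCard m g : ℝ) / (classCard m g ℓ i : ℝ)) else 0

/-- **The block group `N(ℓ)` of a shape**: the subgroup of `Sym(Fin m)` generated by the 3-cycles
of free points lying in one class of `ℓ` — i.e. `∏_B Alt(B)` over the classes `B` of free points
(trivial on classes of size `≤ 2`), extended by the identity on the ordered points; it is contained
in `pointStabiliserBudget m g`. -/
@[folklore] def blockGroup (m g : ℕ) (ℓ : Fin m → ℕ) : Subgroup (Equiv.Perm (Fin m)) :=
  Subgroup.closure {τ | ∃ a b c : Fin m, IsFree m g a ∧ IsFree m g b ∧ IsFree m g c ∧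
    a ≠ b ∧ b ≠ c ∧ a ≠ c ∧ ℓ a = ℓ b ∧ ℓ b = ℓ c ∧ τ = Equiv.swap a b * Equiv.swap b c}

/-- **Block support of a gate.** The shape `ℓ` supports gate `j` of `C` (budget `g`) if every
element of its block group stabilises `j`: some automorphism of `C` extending it fixes `j`
(`Circuit.gateStabiliser`, Anderson–Dawar's `Stab(g)`). With all classes singletons-or-huge this
is the classical notion `Stab(S) ≤ Stab(g)` (`Circuit.Supports`) up to the parity subgroup. -/
@[folklore] def IsBlockSupport (m g : ℕ) (C : Circuit (Fin m × Fin m)) (ℓ : Fin m → ℕ)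
    (j : Fin C.gates.length) : Prop :=
  ∀ ν ∈ blockGroup m g ℓ, ν ∈ C.gateStabiliser (pointStabiliserBudget m g) j

/-- The points PINNED by a shape: the ordered points and the free points in classes of size `≤ 2`
(exactly the points fixed by every element of the block group). -/
@[folklore] def IsPinned (m g : ℕ) (ℓ : Fin m → ℕ) (i : Fin m) : Prop :=
  ¬ IsFree m g i ∨ classCard m g ℓ i ≤ 2

/-- `ℓ'` REFINES `ℓ` on the free points (equivalently: `ℓ` is a coarsening of `ℓ'`). -/
@[folklore] def Refines (m g : ℕ) (ℓ' ℓ : Fin m → ℕ) : Prop :=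
  ∀ a b : Fin m, IsFree m g a → IsFree m g b → ℓ' a = ℓ' b → ℓ a = ℓ b

/-- **One elementary split** (Spoiler's refinement move): `ℓ'` is obtained from `ℓ` by splitting
ONE class of free points into TWO non-empty parts — the classes of `a₀` and `a₁` — all other
classes unchanged, where either the part of `a₀` is a singleton (a PEBBLE move) or both parts have
at least three points (a BLOCK move). Splitting off a pair in one move is not allowed (it would be
two pebbles at once). -/
@[folklore] def IsSplit (m g : ℕ) (ℓ ℓ' : Fin m → ℕ) : Prop :=
  Refines m g ℓ' ℓ ∧ ∃ a₀ a₁ : Fin m, IsFree m g a₀ ∧ IsFree m g a₁ ∧ ℓ a₀ = ℓ a₁ ∧ ℓ' a₀ ≠ ℓ' a₁ ∧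
    (∀ a : Fin m, IsFree m g a → ℓ a = ℓ a₀ → (ℓ' a = ℓ' a₀ ∨ ℓ' a = ℓ' a₁)) ∧
    (∀ a b : Fin m, IsFree m g a → IsFree m g b → ℓ a = ℓ b → ℓ a ≠ ℓ a₀ → ℓ' a = ℓ' b) ∧
    (classCard m g ℓ' a₀ = 1 ∨ (3 ≤ classCard m g ℓ' a₀ ∧ 3 ≤ classCard m g ℓ' a₁))

/-- The ATOMIC (local-isomorphism) condition of a position `(ℓ, h)` between inputs `x` and `y`:
`h` carries `x` to `y` on all pairs of pinned points (this includes the whole ordered part, the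
diagonal, and the free–ordered entries at pinned free points). -/
@[folklore] def IsLocalIso (m g : ℕ) (ℓ : Fin m → ℕ) (h : Equiv.Perm (Fin m))
    (x y : Fin m × Fin m → Bool) : Prop :=
  ∀ u v : Fin m, IsPinned m g ℓ u → IsPinned m g ℓ v → x (u, v) = y (h u, h v)

/-- **A winning strategy for Duplicator in the entropy game** with Spoiler budget `B` (bits) on the
inputs `x`, `y` — a back-and-forth system in group form (compare `BijPebbleStrategy`). Positions are
pairs `(ℓ, h)`: a shape `ℓ` (in `x`-coordinates) and Duplicator's current bijection `h ∈ Bud(m,g)`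
from the `x`-side to the `y`-side, considered up to right multiplication by the block group
`N(ℓ)` (`mul_mem`). Every position is a local isomorphism on pinned points; Spoiler may COARSEN
the shape at will (`coarsen`); and FORTH: Duplicator names a representative `h' ∈ h·N(ℓ)` such that
EVERY elementary split `ℓ'` of `ℓ` of entropy `≤ B` that Spoiler then names leads to the position
`(ℓ', h')` of the system (the bijective forth property: one `h'` answers all splits at once, one
split per round). -/
structure BlockStrategy (m g : ℕ) (B : ℝ) (x y : Fin m × Fin m → Bool) where
  /-- The family of winning positions. -/
  carrier : Set ((Fin m → ℕ) × Equiv.Perm (Fin m))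
  /-- Duplicator's bijections respect the ordered part. -/
  mem_budget : ∀ ⦃P : (Fin m → ℕ) × Equiv.Perm (Fin m)⦄, P ∈ carrier →
    P.2 ∈ pointStabiliserBudget m g
  /-- Every position is a local isomorphism on its pinned points. -/
  isLocalIso : ∀ ⦃P : (Fin m → ℕ) × Equiv.Perm (Fin m)⦄, P ∈ carrier → IsLocalIso m g P.1 P.2 x y
  /-- Positions are cosets of the block group. -/
  mul_mem : ∀ ⦃P : (Fin m → ℕ) × Equiv.Perm (Fin m)⦄, P ∈ carrier →
    ∀ ν ∈ blockGroup m g P.1, (P.1, P.2 * ν) ∈ carrier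
  /-- Spoiler may forget: coarsening the shape keeps a position winning. -/
  coarsen : ∀ ⦃P : (Fin m → ℕ) × Equiv.Perm (Fin m)⦄, P ∈ carrier →
    ∀ ℓ' : Fin m → ℕ, Refines m g P.1 ℓ' → (ℓ', P.2) ∈ carrier
  /-- The bijective forth property, one elementary split per round, within the budget. -/
  forth : ∀ ⦃P : (Fin m → ℕ) × Equiv.Perm (Fin m)⦄, P ∈ carrier →
    ∃ h' : Equiv.Perm (Fin m), P.2⁻¹ * h' ∈ blockGroup m g P.1 ∧
      ∀ ℓ' : Fin m → ℕ, IsSplit m g P.1 ℓ' → ent m g ℓ' ≤ B → (ℓ', h') ∈ carrier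

/-- **Entropy-game equivalence** `x ≈_B y` at budget `B`: Duplicator has a winning strategy
containing the initial position — the one-class shape and some bijection `h ∈ Bud(m,g)` (by
`mul_mem`, a coset of `Alt(free part)`: Duplicator also commits to a parity). -/
@[folklore] def GameEquiv (m g : ℕ) (B : ℝ) (x y : Fin m × Fin m → Bool) : Prop :=
  ∃ 𝔖 : BlockStrategy m g B x y, ∃ h : Equiv.Perm (Fin m), ((fun _ => (0 : ℕ)), h) ∈ 𝔖.carrier

/-- **Order bound for primitive groups** (KNOWN — Praeger–Saxl 1980: a primitive permutation group
of degree `n` not containing `Alt(n)` has order `< 4ⁿ`; Maróti 2002: `< 50·n^{√n}`), stated with an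
existential exponent rate `K` (`K = 2` is Praeger–Saxl), which is all the entropy support theorem
needs. Mathlib has `MulAction.IsPreprimitive` and `alternatingGroup` but no such bound. -/
@[folklore] def PrimitiveOrderBound : Prop :=
  ∃ K : ℕ, ∀ (n : ℕ) (G : Subgroup (Equiv.Perm (Fin n))),
    MulAction.IsPreprimitive G (Fin n) → ¬ alternatingGroup (Fin n) ≤ G → Nat.card G ≤ 2 ^ (K * n)

/-- **The entropy support theorem (EST)** — the lever of the line, pure permutation-group theory:
there is an absolute constant `A` such that EVERY subgroup `H ≤ Sym(Fin g)` contains the block group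
(`∏ Alt` over the classes) of a shape of entropy at most `A · (log₂ |Sym(Fin g) : H| + g)`. (With
`m = g` every point of `Fin g` is free, so `blockGroup g g` / `ent g g` are the plain notions on
`Fin g`.) Extremal examples: Young subgroups (equality up to Stirling), `S_a ≀ S_{g/a}` (blocks of
size `a`), `Alt(g)` (index 2, entropy 0), diagonal `Alt_n ↪ Alt_n × Alt_n` and `S₂ ≀ S_{g/2}` (index
`2^{Θ(g log g)}`, entropy `Θ(g log g)`: the ratio-2 cases). The classical support theorems
(Dixon–Mortimer Thm 5.2A/B; Dawar–Wilsenach 2025 Thm 6.2) are the regime `log₂ index < g`, one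
non-singleton class. -/
@[folklore] def EntropySupportTheorem : Prop :=
  ∃ A : ℕ, ∀ (g : ℕ) (H : Subgroup (Equiv.Perm (Fin g))), ∃ ℓ : Fin g → ℕ,
    blockGroup g g ℓ ≤ H ∧ ent g g ℓ ≤ A * (Real.logb 2 (H.index : ℝ) + g)

/-- **Block supports in the window**: for every polynomial size bound `p` there is a rate `D` such
that every gate of every `Bud(m,⌊log₂ m⌋)`-symmetric circuit of size `≤ p(m)` on `m × m` inputs has
a block support of entropy `≤ D (log₂ m + 1)` — the window substitute for "supports of size `k`". -/
@[folklore] def WindowSupports : Prop :=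
  ∀ p : Polynomial ℕ, ∃ D : ℕ, ∀ (m : ℕ) (C : Circuit (Fin m × Fin m)),
    C.IsSymmetricUnder (pointStabiliserBudget m (Nat.log 2 m)) → C.size ≤ p.eval m →
    ∀ j : Fin C.gates.length, ∃ ℓ : Fin m → ℕ,
      IsBlockSupport m (Nat.log 2 m) C ℓ j ∧ ent m (Nat.log 2 m) ℓ ≤ D * ((Nat.log 2 m : ℝ) + 1)

/-- **Game invariance** (the block analogue of Anderson–Dawar 2017, Thm. 6 / Dawar–Wilsenach 2025,
Thm. 6.4): there is an absolute `A` such that a `Bud(m,g)`-symmetric threshold circuit all of whose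
gates have block supports of entropy `≤ B` takes equal values on inputs that are entropy-game
equivalent at budget `A (B + log₂ g + 1)` (the slack pays for common refinements of a gate's shape
with a child's shape, the `2 log₂ g` of input wires, and pairs re-pinned as two singletons). -/
@[folklore] def GameInvariance : Prop :=
  ∃ A : ℕ, ∀ (m g : ℕ) (B : ℝ) (C : Circuit (Fin m × Fin m)),
    C.IsOver tcBasis → C.IsSymmetricUnder (pointStabiliserBudget m g) →
    (∀ j : Fin C.gates.length, ∃ ℓ : Fin m → ℕ, IsBlockSupport m g C ℓ j ∧ ent m g ℓ ≤ B) →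
    ∀ x y : Fin m × Fin m → Bool,
      GameEquiv m g (A * (B + (Nat.log 2 g : ℝ) + 1)) x y → C.eval x = C.eval y

/-- **The fooling witness** (the open core, card K3): a polynomial-time language whose graph slices
are `Bud(m,⌊log₂ m⌋)`-invariant (the two frame clauses of the crux, verbatim) and which, for every
entropy rate `D`, infinitely often separates a pair of inputs that are entropy-game equivalent at
budget `D · ⌊log₂ m⌋`. -/
@[folklore] def FoolingWitness : Prop :=
  ∃ L ∈ Classes.P,
    (∀ (m : ℕ), ∀ ρ ∈ pointStabiliserBudget m (Nat.log 2 m), ∀ x : Fin m × Fin m → Bool,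
      (encodingGraph.encode ⟨m, Gr m (fun q : Fin m × Fin m => x (ρ q.1, ρ q.2))⟩ ∈ L ↔
        encodingGraph.encode ⟨m, Gr m x⟩ ∈ L)) ∧
    ∀ D : ℕ, ∃ᶠ m in atTop, ∃ x y : Fin m × Fin m → Bool,
      encodingGraph.encode ⟨m, Gr m x⟩ ∈ L ∧ encodingGraph.encode ⟨m, Gr m y⟩ ∉ L ∧
      GameEquiv m (Nat.log 2 m) (D * (Nat.log 2 m : ℝ)) x y

/-! ## Stubs (the five open lemmas of the line) -/

/-- **Stub 1 — order of primitive groups (KNOWN, to be formalised or vendored).**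
`PrimitiveOrderBound`. Why plausible: it is a theorem — Praeger–Saxl, Bull. LMS 12 (1980) 303–307
(`|G| < 4ⁿ`, elementary proof), sharpened by Maróti, J. Algebra 258 (2002) 631–640
(`|G| < 50 n^{√n}`); Babai 1981 for the uniprimitive case. Mathlib: `MulAction.IsPreprimitive`,
`alternatingGroup`, Jordan-type lemmas (`Equiv.Perm.closure_isSwap`-style), no order bound.
Size M/L (the Praeger–Saxl induction on degree through imprimitive/intransitive maximal subgroups
and Bochert's bound). -/
theorem stub_primitiveOrderBound : PrimitiveOrderBound := by
  sorry

/-- **Stub 2 — the entropy support theorem (NEW as stated; the lever).**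
`PrimitiveOrderBound → EntropySupportTheorem`. Why plausible (cost accounting in bits, all terms
additive in `log₂ |Sym : H|`): (1) orbits `O₁,…,O_t` cost the multinomial
`log₂ (g!/∏|Oᵢ|!) ≥ Σ |Oᵢ| log₂(g/|Oᵢ|) − 2g` (Stirling); (2) on an orbit, a maximal block system with
`b` blocks costs `≥ (|O|−b) log₂ b`, and the kernel's action on each block is charged recursively;
(3) a primitive non-alternating top or bottom section of degree `n` costs `≥ n (log₂ n − K − 2)`
(Stub 1), (4) an alternating section `Alt(Δ)` not contained in `H` as `Alt(Δ) × 1` is linked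
diagonally to another section (Goursat; `Alt(Δ)` simple for `|Δ| ≥ 5`) and costs `≥ log₂ |Alt(Δ)|`.
Declaring a class for every unlinked alternating block section and singletons elsewhere gives a
shape whose entropy is at most `2 log₂|Sym : H| + O(g)`; its 3-cycles lie in `H` by construction.
Checked against `S₂ ≀ S_{g/2}` (triage (i): index `2^{Θ(g log g)}`, all singletons, fine),
Young subgroups, `S_a ≀ S_b`, `AGL(d,2)`, diagonals, sign-linked products `{(σ,τ) : sgn σ = sgn τ}`
(contain `Alt × Alt`: the reason for `Alt`, not `Sym`, in `blockGroup`). Why it might fail: a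
constant worse than claimed in step (2) for towers of imprimitivity (absorbed by `A`); nothing
structural. Size L (Mathlib has `alternatingGroup`, `Equiv.Perm.IsThreeCycle`, closure of 3-cycles
`= Alt`, wreath products only ad hoc; Stirling bounds available). -/
theorem stub_est : PrimitiveOrderBound → EntropySupportTheorem := by
  sorry

/-- **Stub 3 — block supports in the window.** `EntropySupportTheorem → WindowSupports`.
Why plausible / plan: (a) `C.gateStabiliser Bud j` is a subgroup of `budgetSubgroup m g`
(composition and inversion of induced automorphisms, `Circuit.IsInducedAut`); (b) its index is
`≤ C.size`: if `ρ Stab ≠ ρ' Stab` then for ANY automorphisms `σ, σ'` extending `ρ, ρ'` the gates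
`σ j ≠ σ' j` (else `σ⁻¹σ'` extends `ρ⁻¹ρ'` and fixes `j`) — the orbit–stabiliser count for possibly
non-rigid circuits (Dawar–Wilsenach 2025 Thm 6.3 flavour; uses `IsSymmetricUnder` to have an
extension of every `ρ`); (c) restriction to the free points is an isomorphism
`budgetSubgroup m g ≃* Sym(Fin (min g m))`; (d) apply EST and pull the shape back (ordered points
get a fresh label), `log₂ index ≤ log₂ p(m) ≤ D_p (log₂ m + 1)`. Why it might fail: only Lean
plumbing (transport of `blockGroup`/`ent` along (c)). Size M. -/
theorem stub_windowSupports : EntropySupportTheorem → WindowSupports := by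
  sorry

/-- **Stub 4 — game invariance (NEW; the block Anderson–Dawar theorem).** `GameInvariance`.
Plan (follows the tree's proof of `AndersonDawar2016_supports_countingWidth_holds`, file
`Literature/ModelTheory/FiniteModelTheory/SymmetricCircuitCountingWidthProofs.lean`, with cosets of
block groups in place of pebbled tuples): for a gate `j` with shape `ℓⱼ` put
`EV_j(x, α) :=` value of `j` on `x ∘ (α × α)`; it is constant on right cosets of `N(ℓⱼ)`
(`Circuit.IsInducedAut.getD_transcript_eq`). CLAIM by induction along the program order: if
`(ℓⱼ ∘ α⁻¹, β α⁻¹)` is a winning position then `EV_j(x, α) = EV_j(y, β)`. For the step, average the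
number of true children over `ν ∈ N(ℓⱼ)` (the automorphisms extending `ν` permute the children,
`EV_{σw}(x,α) = EV_w(x, αν)`), group `ν` by the coset of `N(ℓⱼ) ∩ N(ℓ_w)`, and enumerate these
cosets hierarchically — one elementary split of a class of `ℓⱼ` at a time (block moves for pieces
of size `≥ 3`, pebble moves for points and pairs), Duplicator's representative at each stage
conjugating `x`-side choices onto `y`-side choices inside the strategy (`forth`, then `coarsen` to
the child's own shape) — the block version of `BijPebbleStrategy.sum_indicator_eq`. All shapes met
refine `ℓⱼ ∧ ℓ_w`, of entropy `≤ 2B` (+ `2 log₂ g` for input wires, + `2` bits per pair re-pinned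
as singletons), whence the budget `A (B + log₂ g + 1)`. Output: the output wire is fixed by every
automorphism, so the output gate has the one-class shape — the initial position — and
`C.eval (y ∘ (h × h)) = C.eval y` by `Circuit.IsSymmetricUnder.eval_comp_eq`. Why it might fail:
the parity cosets (`Alt`, not `Sym`, on blocks) must be threaded through the enumeration — they
are, because positions are `N(ℓ)`-cosets of full permutations, but this is the unprinted part.
Size L/XL. -/
theorem stub_gameInvariance : GameInvariance := by
  sorry

/-- **Stub 5 — the fooling witness (OPEN CORE; hardest, load-bearing).** `FoolingWitness`.
What Duplicator must survive, concretely: Spoiler holds a partition of the `g = ⌊log₂ m⌋` free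
vertices of entropy `≤ D g` bits (e.g. `2^D` blocks of size `g/2^D`, or fewer blocks plus
`D g / log₂ g` individualised vertices), refined ONE split per round against Duplicator's
announced bijection and coarsened at will; Duplicator is committed, per block, to the image SET and
to a PARITY. Dead families (the card's BN1–3, confirmed in this game): CFI graphs and every
vertex-gadget 𝔽₂-system planted on the free part — one bisection `S = {b_{e,0}}` freezes the gauge
vector as the set `h(S)`, after which `O(1)` pebbles win: rate `D = 1 + o(1)`; likewise any
Duplicator built from a gauge GROUP `Z ≤ Sym(free)` of vertex permutations with `|Z| ≤ 2^{o(g)}`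
(a generic bisection has trivial setwise stabiliser in `Z`). Live directions named by the route and
the card: 𝔽₂-systems whose unknowns live on PAIRS of free vertices with canonically indexed
equations (2-dimensional coboundary conditions on the clique complex: non-local obstructions are
closed surfaces, and block moves act on vertices, not on pairs); isomorphism of the free part to
the pattern induced on the first `g` ordered vertices (in P by Babai–Luks), where a witness is a
pair of non-isomorphic `g`-vertex graphs equivalent at rate `D` for every `D`. Why it might fail:
Spoiler may win the rate-`D` entropy game on EVERY separated pair for some absolute `D` (the
triage's risk (iv)): then this line dies while `WindowBarrier` stands, and the game would be a
candidate symmetric canonisation scheme in the window (the falsifier TAME of the sibling card).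
Size XL. -/
theorem stub_witness : FoolingWitness := by
  sorry

/-! ## Name-keyed aliases of the five stub statements (hypotheses of the composition)

`Registered.stub_X` is the statement of `stub_X` under the registered stub's short name, so that the
native skeleton audit (`#h21_check_skeleton`: hypotheses admissible iff registered obligations /
declared stubs BY NAME) accepts
`WindowBarrier_of : Registered.stub_primitiveOrderBound → … → WindowBarrier` (device of
`CriticalPhenomena/CardyFormulaZ2/Cruxes/LagHandOff/Lines/crosscut-dictionary.lean`). -/
namespace Registered

/-- Alias of `PrimitiveOrderBound` keyed by the registered stub name. -/
abbrev stub_primitiveOrderBound : Prop := PrimitiveOrderBound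
/-- Alias of the statement of `stub_est`. -/
abbrev stub_est : Prop := PrimitiveOrderBound → EntropySupportTheorem
/-- Alias of the statement of `stub_windowSupports`. -/
abbrev stub_windowSupports : Prop := EntropySupportTheorem → WindowSupports
/-- Alias of `GameInvariance` keyed by the registered stub name. -/
abbrev stub_gameInvariance : Prop := GameInvariance
/-- Alias of `FoolingWitness` keyed by the registered stub name. -/
abbrev stub_witness : Prop := FoolingWitness

end Registered

/-! ## Glue (sorry-free) -/

/-- A larger Spoiler budget only restricts Duplicator: game equivalence is antitone in the budget. -/
theorem GameEquiv.mono {m g : ℕ} {B B' : ℝ} {x y : Fin m × Fin m → Bool} (hBB' : B ≤ B')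
    (h : GameEquiv m g B' x y) : GameEquiv m g B x y := by
  obtain ⟨𝔖, h₀, hh₀⟩ := h
  refine ⟨{ carrier := 𝔖.carrier
            mem_budget := 𝔖.mem_budget
            isLocalIso := 𝔖.isLocalIso
            mul_mem := 𝔖.mul_mem
            coarsen := 𝔖.coarsen
            forth := fun P hP => ?_ }, h₀, hh₀⟩
  obtain ⟨h', hh', hforth⟩ := 𝔖.forth hP
  exact ⟨h', hh', fun ℓ' hsplit hent => hforth ℓ' hsplit (hent.trans hBB')⟩

/-- The budget arithmetic of the composition: for `g ≥ 1`,
`A (D (g + 1) + log₂ g + 1) ≤ 2 A (D + 1) g`. -/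
theorem budget_le (A D g : ℕ) (hg : 1 ≤ g) :
    (A : ℝ) * ((D : ℝ) * ((g : ℝ) + 1) + (Nat.log 2 g : ℝ) + 1) ≤ ((2 * A * (D + 1) : ℕ) : ℝ) * g := by
  have hg' : (1 : ℝ) ≤ g := by exact_mod_cast hg
  have hlog : (Nat.log 2 g : ℝ) ≤ g := by exact_mod_cast Nat.log_le_self 2 g
  have hA : (0 : ℝ) ≤ A := Nat.cast_nonneg A
  have hD : (0 : ℝ) ≤ D := Nat.cast_nonneg D
  have hinner : (D : ℝ) * ((g : ℝ) + 1) + (Nat.log 2 g : ℝ) + 1 ≤ 2 * ((D : ℝ) + 1) * g := by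
    nlinarith
  calc (A : ℝ) * ((D : ℝ) * ((g : ℝ) + 1) + (Nat.log 2 g : ℝ) + 1)
      ≤ (A : ℝ) * (2 * ((D : ℝ) + 1) * g) := mul_le_mul_of_nonneg_left hinner hA
    _ = ((2 * A * (D + 1) : ℕ) : ℝ) * g := by push_cast; ring

/-! ### The composition (concludes the crux BY NAME) -/

/-- **`WindowBarrier` from the five stubs.** The witness supplies `L ∈ P` and the invariance
clause verbatim; given a polynomial `p`, `WindowSupports` (from EST, from the primitive bound)
gives the entropy rate `D` of block supports of all gates of all `Bud(m,⌊log₂ m⌋)`-symmetric circuits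
of size `≤ p(m)`; the witness at rate `2A(D+1)` gives infinitely many `m ≥ 2` with a separated but
game-equivalent pair `x, y`; a symmetric circuit of size `≤ p(m)` computing the slice would take
equal values on `x` and `y` by `GameInvariance` — contradiction. The inline `let` vocabulary of the
route (`Sym`, `HasSym`, `Bud`, `Gr`) is definitionally `IsSymmetricUnder`, `HasSymCircuit tcBasis`,
`pointStabiliserBudget`, `Gr` (`Circuit.isSymmetricUnder_iff` is `Iff.rfl`). -/
theorem WindowBarrier_of (h₁ : Registered.stub_primitiveOrderBound) (h₂ : Registered.stub_est)
    (h₃ : Registered.stub_windowSupports) (h₄ : Registered.stub_gameInvariance)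
    (h₅ : Registered.stub_witness) :
    Summit.PneNP.PneNP.Theses.SymmetryBudget.WindowBarrier := by
  have hWS : WindowSupports := h₃ (h₂ h₁)
  obtain ⟨A, hA⟩ := h₄
  obtain ⟨L, hLP, hinv, hfool⟩ := h₅
  show ∃ L ∈ Classes.P,
    (∀ (m : ℕ), ∀ ρ ∈ pointStabiliserBudget m (Nat.log 2 m), ∀ x : Fin m × Fin m → Bool,
      (encodingGraph.encode ⟨m, Gr m (fun q : Fin m × Fin m => x (ρ q.1, ρ q.2))⟩ ∈ L ↔
        encodingGraph.encode ⟨m, Gr m x⟩ ∈ L)) ∧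
    ∀ p : Polynomial ℕ, ∃ᶠ m in atTop, ¬ HasSymCircuit tcBasis
      (pointStabiliserBudget m (Nat.log 2 m)) (p.eval m)
      (fun x : Fin m × Fin m → Bool => decide (encodingGraph.encode ⟨m, Gr m x⟩ ∈ L))
  refine ⟨L, hLP, hinv, fun p => ?_⟩
  obtain ⟨D, hD⟩ := hWS p
  have hfreq := (hfool (2 * A * (D + 1))).and_eventually (eventually_ge_atTop 2)
  refine hfreq.mono ?_
  rintro m ⟨⟨x, y, hx, hy, hxy⟩, hm⟩ ⟨C, hB, hsize, hsym, hcomp⟩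
  have hg : 1 ≤ Nat.log 2 m := Nat.log_pos one_lt_two hm
  have hsupp := hD m C hsym hsize
  have hxy' : GameEquiv m (Nat.log 2 m)
      (A * ((D : ℝ) * ((Nat.log 2 m : ℝ) + 1) + (Nat.log 2 (Nat.log 2 m) : ℝ) + 1)) x y :=
    hxy.mono (budget_le A D (Nat.log 2 m) hg)
  have heval : C.eval x = C.eval y :=
    hA m (Nat.log 2 m) ((D : ℝ) * ((Nat.log 2 m : ℝ) + 1)) C hB hsym hsupp x y hxy'
  have hx' : C.eval x = decide (encodingGraph.encode ⟨m, Gr m x⟩ ∈ L) := hcomp x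
  have hy' : C.eval y = decide (encodingGraph.encode ⟨m, Gr m y⟩ ∈ L) := hcomp y
  rw [decide_eq_true hx] at hx'
  rw [decide_eq_false hy] at hy'
  rw [hx', hy'] at heval
  exact Bool.noConfusion heval

/-- Wiring check: the registered stubs feed `WindowBarrier_of` as stated (sorries only via the stubs). -/
example : Summit.PneNP.PneNP.Theses.SymmetryBudget.WindowBarrier :=
  WindowBarrier_of stub_primitiveOrderBound stub_est stub_windowSupports stub_gameInvariance
    stub_witness

end Summit.PneNP.PneNP.Cruxes.WindowBarrier.EntropySupportDichotomy

end
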